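import Summits.BirchSwinnertonDyer.BirchSwinnertonDyer.Theses.KolyvaginRankRigidityAtTwo
import HarnessLib

/-!
# TURNKEY (lead krr2-p1 g7) for the pen of route `KolyvaginRankRigidityAtTwo` — R4-∞ (the METHOD-PROOF
# form of the pair): V1′∞ = Kolyvagin's STRONG NON-ZERO SYSTEM at 2 (Math. Ann. 291 (2.1), fixed depth
# `r`, every relative margin), V2♭∞ = the corank lower bound from a RICH seed; deciding theorem re-checked

WHY (crux-dir memo `SWAP-LEDGER.md`). The prime swap at level `2^M` is lossless in the WINDOW phase
(fresh primes of one index band and Frobenius type) but in the SEED phase (swapping out the GIVEN seed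
primes, of lower index and arbitrary Frobenius type, for fresh ones) three `±1`-bit effects (Sah bit of
the index band on the auxiliary class and on the transfer, the type bit of the local pairing) need not
cancel: up to a constant `c₂` bits per swap, `ν` swaps ⇒ a loss growing with the depth `ν`. With a
single `(θ, k)` chosen before `ν` (V2♭θ, 27220) this is not absorbed for all `ν`; with a RICH seed (for
EVERY `θ, k` a non-zero class at depth `ν` — exactly what Kolyvagin's strong non-zero system (2.1)
provides at its depth `r`) it is: the lead picks `θ = 2`, `k = c₀ + 2c₁ + (2ν+2)c₂ + 1` (landed
composition `windowsRich_of_lossySwap`, p622030). Minimality is asked only in the form the windows use: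
below `ν`, for SOME `(θ, k)`, the `(θ, k)`-strong classes vanish.

* `KolyvaginStrongNonzeroSystemAtTwo` (V1′∞): V1′θ's habitat/frame, then `∃ r, ∀ θ k, ∃` a non-zero
  class of depth EXACTLY `r` with `θ·M + k ≤ M(n)` — Kolyvagin's Conj. 2.5 / (2.1) at `ℓ = 2` verbatim
  in relative-margin currency (implies V1′θ: `theta_of_strongSystem`).
* `KolyvaginCorankLowerBoundAtTwoRich` (V2♭∞): V2♭'s habitat, then for every frame and depth `ν`:
  RICH(ν) (`∀ θ k ∃` non-zero `(θ,k)`-strong class of depth `ν`) and, for every `ν' < ν`, SOME `(θ, k)`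
  with all `(θ,k)`-strong classes of depth `ν'` zero ⟹ `ν + 1 ≤ c ∨ ν + 1 ≤ c'`.
`closes_rich` = the route's `closes` VERBATIM with the pair replaced: take `r` from V1′∞, the least
rich depth `ν ≤ r` (`Nat.find`); below it richness fails, i.e. some `(θ, k)` has no strong class;
V2♭∞ gives `ν = 0`, so a non-zero class of conductor `1`, and Gross–Zagier finishes as before.
This file is EVIDENCE for a route edit (items are the planner's, D-0014). BSD is not proved by this.
-/

set_option linter.dupNamespace false

namespace Summit.BirchSwinnertonDyer.BirchSwinnertonDyer.Theses.KolyvaginRankRigidityAtTwo.RichTurnkey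

open scoped BigOperators Classical
open Summit.BirchSwinnertonDyer.BirchSwinnertonDyer.Theses.KolyvaginRankRigidityAtTwo Literature

/-- **V1′∞ — Kolyvagin's STRONG NON-ZERO SYSTEM at `2`** (Math. Ann. 291, p. 259, (2.1) and Conj. 2.5,
in relative-margin currency; candidate successor of V1′θ 27219): for some depth `r` and every `θ, k`
there is a non-zero class `c_M(n)` of depth exactly `r` with `θ·M + k ≤ M(n)`.
[cite: Kolyvagin1991MathAnn, p. 259 ((2.1), Conj. 2.5), p. 257 (θ m_f < m(p₀))] -/
def KolyvaginStrongNonzeroSystemAtTwo : Prop :=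
  ∀ (W : WeierstrassCurve ℚ) [W.IsElliptic] [W.IsGloballyMinimal], ¬ W.HasCM → (Literature.NumberTheory.EllipticCurves.Rank1Residual.GoodOrd W 2 ∨ Literature.NumberTheory.EllipticCurves.Rank1Residual.Mult W 2) → (∀ m : ℕ, W.HasSurjectiveModNGaloisRep (2 ^ m : ℕ)) → ∀ (K : Type) [Field K] [NumberField K], Literature.NumberTheory.EllipticCurves.IsImaginaryQuadratic K → ∀ [NeZero (W.conductorNorm ℤ)], Literature.NumberTheory.EllipticCurves.SatisfiesHeegnerHypothesis (W.conductorNorm ℤ) K → Odd (NumberField.discr K) → NumberField.discr K ≠ -3 → AddSubgroup.torsionBy (W.baseChange K).toAffine.Point (2 : ℤ) = ⊥ → Literature.NumberTheory.EllipticCurves.SatisfiesHeegnerHypothesis 2 K → ∀ (Dt : Literature.NumberTheory.EllipticCurves.ModularForms.ModularParametrizationData W (W.conductorNorm ℤ)) (β : ℤ) (ι : K →+* ℂ), (4 * (W.conductorNorm ℤ : ℤ)) ∣ β ^ 2 - NumberField.discr K → ∃ r : ℕ, ∀ θ k : ℕ, ∃ (n : ℕ) (d : Literature.NumberTheory.EllipticCurves.KolyvaginHeegnerData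 Dt β ι n) (M : ℕ), Literature.NumberTheory.EllipticCurves.KolyvaginDescent.KolSupp (Literature.NumberTheory.EllipticCurves.Zhang2014.IsKolyvaginPrime (W.conductorNorm ℤ) W K 2) n ∧ n.primeFactors.card = r ∧ 1 ≤ M ∧ ((θ * M + k : ℕ) : ℕ∞) ≤ Literature.NumberTheory.EllipticCurves.Zhang2014.levelIndex W 2 n ∧ d.kolyvaginClass Nat.prime_two M ≠ 0

/-- **V2♭∞ — the corank lower bound at `2` from a RICH seed** (candidate successor of V2♭θ 27220): for
every frame and depth `ν`, if for EVERY `θ, k` there is a non-zero class of depth `ν` with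
`θ·M + k ≤ M(n)`, and for every smaller depth `ν'` SOME `(θ, k)` has no non-zero `(θ,k)`-strong class of
depth `ν'`, then `ν + 1 ≤ c ∨ ν + 1 ≤ c'` — Kolyvagin's Thm. 2.2 at `2` in the exact form his window
argument proves it (the rich seed pays any depth-dependent constant loss of the seed-phase swaps).
[cite: Kolyvagin1991MathAnn, §2 Thm. 2.2–2.3, p. 257, p. 259 (2.1)] -/
def KolyvaginCorankLowerBoundAtTwoRich : Prop :=
  ∀ (W : WeierstrassCurve ℚ) [W.IsElliptic] [W.IsGloballyMinimal], ¬ W.HasCM → (Literature.NumberTheory.EllipticCurves.Rank1Residual.GoodOrd W 2 ∨ Literature.NumberTheory.EllipticCurves.Rank1Residual.Mult W 2) → (∀ m : ℕ, W.HasSurjectiveModNGaloisRep (2 ^ m : ℕ)) → ∀ (K : Type) [Field K] [NumberField K], Literature.NumberTheory.EllipticCurves.IsImaginaryQuadratic K → NumberField.discr K ≠ -3 → NumberField.discr K ≠ -4 → ¬ ((2 : ℤ) ∣ NumberField.discr K) → ∀ [NeZero (W.conductorNorm ℤ)], Literature.NumberTheory.EllipticCurves.SatisfiesHeegnerHypothesis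 (W.conductorNorm ℤ) K → ∀ (Dt : Literature.NumberTheory.EllipticCurves.ModularForms.ModularParametrizationData W (W.conductorNorm ℤ)) (β : ℤ) (ι : K →+* ℂ) (ν : ℕ), (∀ θ k : ℕ, ∃ (n : ℕ) (d : Literature.NumberTheory.EllipticCurves.KolyvaginHeegnerData Dt β ι n) (M : ℕ), Literature.NumberTheory.EllipticCurves.KolyvaginDescent.KolSupp (Literature.NumberTheory.EllipticCurves.Zhang2014.IsKolyvaginPrime (W.conductorNorm ℤ) W K 2) n ∧ n.primeFactors.card = ν ∧ 1 ≤ M ∧ ((θ * M + k : ℕ) : ℕ∞) ≤ Literature.NumberTheory.EllipticCurves.Zhang2014.levelIndex W 2 n ∧ d.kolyvaginClass Nat.prime_two M ≠ 0) → (∀ ν' : ℕ, ν' < ν → ∃ θ k : ℕ, ∀ (n' : ℕ) (d' : Literature.NumberTheory.EllipticCurves.KolyvaginHeegnerData Dt β ι n') (M' : ℕ), Literature.NumberTheory.EllipticCurves.KolyvaginDescent.KolSupp (Literature.NumberTheory.EllipticCurves.Zhang2014.IsKolyvaginPrime (W.conductorNorm ℤ) W K 2) n' → 1 ≤ M' →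 ((θ * M' + k : ℕ) : ℕ∞) ≤ Literature.NumberTheory.EllipticCurves.Zhang2014.levelIndex W 2 n' → n'.primeFactors.card = ν' → d'.kolyvaginClass Nat.prime_two M' = 0) → (ν + 1 ≤ W.selmerCorank 2 ∨ ν + 1 ≤ (W.quadraticTwist (NumberField.discr K : ℚ)).selmerCorank 2)

/-- V1′∞ implies V1′θ (27219, as filed): forget the depth. [cite: Kolyvagin1991MathAnn, p. 259] -/
theorem theta_of_strongSystem (h : KolyvaginStrongNonzeroSystemAtTwo) :
    KolyvaginNonvanishingAtTwoFrameTheta := by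
  intro W _ _ hCM hred hsur K _ _ hK _ hHN hodd hne3 htor hH2 Dt β ι hβ θ k
  obtain ⟨r, hr⟩ := h W hCM hred hsur K hK hHN hodd hne3 htor hH2 Dt β ι hβ
  obtain ⟨n, d, M, hn, -, hM1, hMle, hne⟩ := hr θ k
  exact ⟨n, d, M, hn, hM1, hMle, hne⟩

/-- **The deciding theorem with the rich pair** — the route's `closes` VERBATIM except that V1′∞
supplies a rich depth, the least rich depth is taken (`Nat.find`), and V2♭∞ forces it to be `0`. It
concludes the registered leaf `Rank1Residual.NonCMTwoConverse`.
[cite: Kolyvagin1991MathAnn, §2] [cite: GrossZagier1986, I (6.1)] -/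
theorem closes_rich (hV1 : KolyvaginStrongNonzeroSystemAtTwo)
    (hV2 : KolyvaginCorankLowerBoundAtTwoRich)
    (hR : OffHabitatNonSurjTwoConverse) (hIn : PrintedInputsRankOneAtTwo) (hT : NoTwoTorsionOverK)
    (hf : BFHTwistSupply) (h0 : SimpleZeroTwistSplitAtTwoOfBFH) (hGZK : MultPublishedInputsAtTwo)
    (hMod : NewformOfEllipticCurve) (hHLT : HoffsteinLuoNonvanishingTwist) (hEnt : EntireLFunctionRat) :
    Summit.BirchSwinnertonDyer.BirchSwinnertonDyer.Rank1Residual.NonCMTwoConverse := by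
  have hBFH : SimpleZeroTwistSplitAtTwo := h0 hf
  intro W _ _ hCM hred r hr hc
  by_cases hsur : (∀ m : ℕ, W.HasSurjectiveModNGaloisRep (2 ^ m : ℕ))
  swap
  · exact hR W hCM hred r hr hc hsur
  obtain ⟨-, -, hpar, hKato, -, hGZ, hrec⟩ := hIn
  have hmod : Literature.NumberTheory.EllipticCurves.ModularForms.exists_isNewformOf := hMod
  have hHL : Literature.NumberTheory.EllipticCurves.HoffsteinLuo1997_exists_twist_L_one_ne_zero := hHLT
  have hE : WeierstrassCurve.hasEntireLFunction_rat := hEnt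
  have hGZK' : Literature.NumberTheory.EllipticCurves.rank_eq_analyticRank_of_analyticRank_le_one := hGZK
  haveI : Fact (Nat.Prime 2) := ⟨Nat.prime_two⟩
  haveI : NeZero (W.conductorNorm ℤ) := ⟨(W.conductorNorm_pos_holds).ne'⟩
  obtain rfl | rfl : r = 0 ∨ r = 1 := by omega
  · -- ===== r = 0 : partner twist with a simple zero (BFH 1990 (i), `2` split) =====
    have hw : W.rootNumber = 1 := by
      have h := hpar W
      unfold Literature.NumberTheory.EllipticCurves.p_parity at h
      rw [hc, pow_zero] at h
      exact h.symm
    obtain ⟨K, _, _, hK, -, hHN, hH2, hd8, hL0, hL1⟩ := hBFH W hw 0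
    have hodd : Odd (NumberField.discr K) := by
      rw [Int.odd_iff]; omega
    have hne3 : NumberField.discr K ≠ -3 := by omega
    have hne4 : NumberField.discr K ≠ -4 := by omega
    have h2d : ¬ ((2 : ℤ) ∣ NumberField.discr K) := by omega
    have hd : (NumberField.discr K : ℚ) ≠ 0 := by exact_mod_cast NumberField.discr_ne_zero K
    haveI := W.isElliptic_quadraticTwist hd
    have hr1 : (W.quadraticTwist (NumberField.discr K : ℚ)).analyticRank = 1 :=
      Literature.NumberTheory.EllipticCurves.analyticRank_eq_one_of_entireLFunction_one_eq_zero_of_deriv_ne_zero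
        _ (hE _) hL0 hL1
    obtain ⟨hrk, hsha⟩ := hGZK' (W.quadraticTwist (NumberField.discr K : ℚ)) (le_of_eq hr1)
    rw [hr1] at hrk
    haveI := hsha
    have hc' : (W.quadraticTwist (NumberField.discr K : ℚ)).selmerCorank 2 = 1 :=
      Literature.NumberTheory.EllipticCurves.selmerCorank_eq_one_of_mordellWeilRank_eq_one_of_finite
        (W.quadraticTwist (NumberField.discr K : ℚ)) 2 hrk inferInstance
    have htor := hT W hsur K hK
    obtain ⟨fW, hfW⟩ := hMod W
    obtain ⟨Dt⟩ :=
      Literature.NumberTheory.Automorphic.nonempty_modularParametrizationData_of_isNewformOf hfW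
    obtain ⟨β, hβ⟩ := Literature.NumberTheory.EllipticCurves.exists_dvd_sq_sub_discr_holds (W.conductorNorm ℤ) K hK hHN
    obtain ⟨ι⟩ := (inferInstance : Nonempty (K →+* ℂ))
    obtain ⟨r, hr⟩ := hV1 W hCM hred hsur K hK hHN hodd hne3 htor hH2 Dt β ι hβ
    -- the least RICH depth `ν ≤ r`
    have hex : ∃ ν : ℕ, ∀ θ k : ℕ, ∃ (n : ℕ)
        (d : Literature.NumberTheory.EllipticCurves.KolyvaginHeegnerData Dt β ι n) (M : ℕ),
        Literature.NumberTheory.EllipticCurves.KolyvaginDescent.KolSupp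
          (Literature.NumberTheory.EllipticCurves.Zhang2014.IsKolyvaginPrime (W.conductorNorm ℤ) W K 2) n ∧
        n.primeFactors.card = ν ∧ 1 ≤ M ∧
        ((θ * M + k : ℕ) : ℕ∞) ≤ Literature.NumberTheory.EllipticCurves.Zhang2014.levelIndex W 2 n ∧
        d.kolyvaginClass Nat.prime_two M ≠ 0 := ⟨r, hr⟩
    have hrich := Nat.find_spec hex
    have hbelow : ∀ ν' : ℕ, ν' < Nat.find hex → ∃ θ k : ℕ, ∀ (n' : ℕ)
        (d' : Literature.NumberTheory.EllipticCurves.KolyvaginHeegnerData Dt β ι n') (M' : ℕ),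
        Literature.NumberTheory.EllipticCurves.KolyvaginDescent.KolSupp
          (Literature.NumberTheory.EllipticCurves.Zhang2014.IsKolyvaginPrime (W.conductorNorm ℤ) W K 2) n' →
        1 ≤ M' →
        ((θ * M' + k : ℕ) : ℕ∞) ≤ Literature.NumberTheory.EllipticCurves.Zhang2014.levelIndex W 2 n' →
        n'.primeFactors.card = ν' → d'.kolyvaginClass Nat.prime_two M' = 0 := by
      intro ν' hν'
      have h := Nat.find_min hex hν'
      rw [not_forall] at h
      obtain ⟨θ, h⟩ := h
      rw [not_forall] at h
      obtain ⟨k, hθk⟩ := h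
      exact ⟨θ, k, fun n' d' M' hn' hM' hle hcard ↦ by
        by_contra hne'; exact hθk ⟨n', d', M', hn', hcard, hM', hle, hne'⟩⟩
    -- the ONLY use of V2: the lower bound `ν + 1 ≤ max(c, c') = 1` forces `ν = 0`
    have hstruct := hV2 W hCM hred hsur K hK hne3 hne4 h2d hHN Dt β ι (Nat.find hex) hrich hbelow
    have hν : Nat.find hex = 0 := by
      rcases hstruct with h1 | h1 <;> omega
    rw [hν] at hrich
    obtain ⟨n₀, d₀, M₀, hn₀, hν0, hM₀, -, hne₀⟩ := hrich 0 0
    have hn1 : n₀ = 1 := by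
      rw [Finset.card_eq_zero, Nat.primeFactors_eq_empty] at hν0
      rcases hν0 with h0 | h1
      · exact absurd (h0 ▸ hn₀.1) not_squarefree_zero
      · exact h1
    subst hn1
    have hEK : Literature.NumberTheory.EllipticCurves.analyticRankEK W K = 1 :=
      Literature.NumberTheory.EllipticCurves.heegnerSystem_analyticRankEK_eq_one_of_kolyvaginClass_one_ne_zero
        (hGZ W _ K) (hrec _ W K) hK rfl hHN d₀ hne₀
    rw [Literature.NumberTheory.EllipticCurves.analyticRankEK_eq_add_of hE W K, hr1] at hEK
    omega
  · -- ===== r = 1 : partner twist with L(E^{(d_K)}, 1) ≠ 0 (Hoffstein–Luo) =====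
    have hw : W.rootNumber = -1 := by
      have h := hpar W
      unfold Literature.NumberTheory.EllipticCurves.p_parity at h
      rw [hc, pow_one] at h
      exact h.symm
    obtain ⟨K, _, _, hK, -, hHN, hH2, hd8, hL1⟩ :=
      Literature.NumberTheory.EllipticCurves.exists_heegnerField_split_twist_ne_zero_discr_emod_eight_of_hoffsteinLuo
        hmod hHL W hw Nat.prime_two 0
    have hodd : Odd (NumberField.discr K) := by
      rw [Int.odd_iff]; omega
    have hne3 : NumberField.discr K ≠ -3 := by omega
    have hne4 : NumberField.discr K ≠ -4 := by omega
    have h2d : ¬ ((2 : ℤ) ∣ NumberField.discr K) := by omega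
    have hd : (NumberField.discr K : ℚ) ≠ 0 := by exact_mod_cast NumberField.discr_ne_zero K
    haveI := W.isElliptic_quadraticTwist hd
    obtain ⟨-, -, hfin⟩ := hKato (W.quadraticTwist (NumberField.discr K : ℚ)) hL1
    haveI := hfin
    have hc' : (W.quadraticTwist (NumberField.discr K : ℚ)).selmerCorank 2 = 0 :=
      (W.quadraticTwist (NumberField.discr K : ℚ)).selmerCorank_eq_zero_of_finite 2
    have htor := hT W hsur K hK
    obtain ⟨fW, hfW⟩ := hMod W
    obtain ⟨Dt⟩ :=
      Literature.NumberTheory.Automorphic.nonempty_modularParametrizationData_of_isNewformOf hfW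
    obtain ⟨β, hβ⟩ := Literature.NumberTheory.EllipticCurves.exists_dvd_sq_sub_discr_holds (W.conductorNorm ℤ) K hK hHN
    obtain ⟨ι⟩ := (inferInstance : Nonempty (K →+* ℂ))
    obtain ⟨r, hr⟩ := hV1 W hCM hred hsur K hK hHN hodd hne3 htor hH2 Dt β ι hβ
    -- the least RICH depth `ν ≤ r`
    have hex : ∃ ν : ℕ, ∀ θ k : ℕ, ∃ (n : ℕ)
        (d : Literature.NumberTheory.EllipticCurves.KolyvaginHeegnerData Dt β ι n) (M : ℕ),
        Literature.NumberTheory.EllipticCurves.KolyvaginDescent.KolSupp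
          (Literature.NumberTheory.EllipticCurves.Zhang2014.IsKolyvaginPrime (W.conductorNorm ℤ) W K 2) n ∧
        n.primeFactors.card = ν ∧ 1 ≤ M ∧
        ((θ * M + k : ℕ) : ℕ∞) ≤ Literature.NumberTheory.EllipticCurves.Zhang2014.levelIndex W 2 n ∧
        d.kolyvaginClass Nat.prime_two M ≠ 0 := ⟨r, hr⟩
    have hrich := Nat.find_spec hex
    have hbelow : ∀ ν' : ℕ, ν' < Nat.find hex → ∃ θ k : ℕ, ∀ (n' : ℕ)
        (d' : Literature.NumberTheory.EllipticCurves.KolyvaginHeegnerData Dt β ι n') (M' : ℕ),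
        Literature.NumberTheory.EllipticCurves.KolyvaginDescent.KolSupp
          (Literature.NumberTheory.EllipticCurves.Zhang2014.IsKolyvaginPrime (W.conductorNorm ℤ) W K 2) n' →
        1 ≤ M' →
        ((θ * M' + k : ℕ) : ℕ∞) ≤ Literature.NumberTheory.EllipticCurves.Zhang2014.levelIndex W 2 n' →
        n'.primeFactors.card = ν' → d'.kolyvaginClass Nat.prime_two M' = 0 := by
      intro ν' hν'
      have h := Nat.find_min hex hν'
      rw [not_forall] at h
      obtain ⟨θ, h⟩ := h
      rw [not_forall] at h
      obtain ⟨k, hθk⟩ := h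
      exact ⟨θ, k, fun n' d' M' hn' hM' hle hcard ↦ by
        by_contra hne'; exact hθk ⟨n', d', M', hn', hcard, hM', hle, hne'⟩⟩
    -- the ONLY use of V2: the lower bound `ν + 1 ≤ max(c, c') = 1` forces `ν = 0`
    have hstruct := hV2 W hCM hred hsur K hK hne3 hne4 h2d hHN Dt β ι (Nat.find hex) hrich hbelow
    have hν : Nat.find hex = 0 := by
      rcases hstruct with h1 | h1 <;> omega
    rw [hν] at hrich
    obtain ⟨n₀, d₀, M₀, hn₀, hν0, hM₀, -, hne₀⟩ := hrich 0 0
    have hn1 : n₀ = 1 := by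
      rw [Finset.card_eq_zero, Nat.primeFactors_eq_empty] at hν0
      rcases hν0 with h0 | h1
      · exact absurd (h0 ▸ hn₀.1) not_squarefree_zero
      · exact h1
    subst hn1
    have hEK : Literature.NumberTheory.EllipticCurves.analyticRankEK W K = 1 :=
      Literature.NumberTheory.EllipticCurves.heegnerSystem_analyticRankEK_eq_one_of_kolyvaginClass_one_ne_zero
        (hGZ W _ K) (hrec _ W K) hK rfl hHN d₀ hne₀
    rw [Literature.NumberTheory.EllipticCurves.analyticRankEK_eq_add_of hE W K,
      Literature.NumberTheory.EllipticCurves.analyticRank_eq_zero_of_entireLFunction_one_ne_zero _ hL1,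
      add_zero] at hEK
    exact hEK


end Summit.BirchSwinnertonDyer.BirchSwinnertonDyer.Theses.KolyvaginRankRigidityAtTwo.RichTurnkey
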